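import Summits.QuantumFields.QCD.Theorems.EarlyCrosserLaw.Negative.LowerPinLoadBearing

/-!
# Crux `EarlyCrosserLaw` (route `NestedDissectionSea`, item stmt-QuantumFields-13995), negative side —
# on the physical branch `m_crit → 0` the lower pin (b) is still the only load-bearing clause

Companion of `LowerPinLoadBearing.lean` (same directory, same namespace and vocabulary:
`DilutionClause` (a′), `UpperPin` (b″), `EarlyCrosserLawWithoutLowerPinAt` = the crux body with the
lower pin (b) deleted).  The reshaped pin stub of line `cells-inherit-torus-extinction` adds the
physical-branch conjunct `Tendsto reg.mcrit atTop (𝓝 0)` to the witness; this file certifies that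
EVEN ON THE BRANCH deleting (b) makes the crux a theorem:

* `withoutLowerPinAt_canonicalAF`: along the tree's `QCDRegularisation.canonicalAF Nf`
  (`m_crit ≡ 0`, canonical `Z_m`, `β_k = afBeta N_f 1 a_k`; both scalings inherited) clauses (a′)
  and (b″) hold for EVERY `N_f`, with `M₀ = 0`, `b₀ = 2`, `ℓ = R = 1`, `δ ≡ 0`: every bare mass
  `a_k m_f / Z_m(k)` is `> 0`, so no Dirichlet cell is singular at a bare mass `≥ m_f(k)`
  (`wilsonCell_det_ne_zero_of_pos`) — the cover event of (a′) is EMPTY — and `Re det D_W > 0` at the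
  upper pin mass (Seiler, `fermionDet_wilsonDirac_re_pos`) — the indicator of (b″) vanishes.
* `onBranch_withoutLowerPin_holds`: hence `∃ reg, m_crit → 0 ∧ (a′) ∧ (b″)` (with the scalings);
  `onBranch_upperPin_holds`: its projection onto the scalings, the branch conjunct and (b″).

Standard material [folklore]; no Theses statement is asserted positively.
-/

noncomputable section

open Matrix Complex Filter
open Literature.MathematicalPhysics.QuantumLattice Literature.MathematicalPhysics.QuantumFieldTheory
  Literature.Probability.LatticeModels
open Summit.QuantumFields.QCD.Theses.NestedDissectionSea
open Summit.QuantumFields.QCD.Theorems.CoerciveSeaNegative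

namespace Summit.QuantumFields.QCD.Theorems.EarlyCrosserLawNegative

section OnBranch

open scoped Classical

/-- The critical mass of `canonicalAF` is identically `0`. [folklore] -/
theorem canonicalAF_mcrit (Nf k : ℕ) : (QCDRegularisation.canonicalAF Nf).mcrit k = 0 := rfl

/-- `canonicalAF` lies on the physical branch: `m_crit(k) → 0` (it is constantly `0`). [folklore] -/
theorem canonicalAF_tendsto_mcrit (Nf : ℕ) :
    Tendsto (QCDRegularisation.canonicalAF Nf).mcrit atTop (nhds 0) :=
  tendsto_const_nhds

/-- The scheme of `canonicalAF` scales asymptotically (`β_k = afBeta N_f 1 a_k`, `Λ = 1`). [folklore] -/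
theorem canonicalAF_hasAsymptoticScaling (Nf : ℕ) :
    ((QCDRegularisation.canonicalAF Nf).scheme 0 0 0).HasAsymptoticScaling :=
  ⟨1, one_pos, by
    simp [QCDRegularisation.scheme, QCDRegularisation.canonicalAF, QCDScheme.zeroAF]⟩

/-- Along `canonicalAF` the bare mass `m_crit(k) + a_k M / Z_m(k) = a_k M / Z_m(k)` of a positive
renormalised mass `M` is positive. [folklore] -/
theorem canonicalAF_bareMass_pos (Nf : ℕ) {M : ℝ} (hM : 0 < M) (k : ℕ) :
    0 < (QCDRegularisation.canonicalAF Nf).mcrit k +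
      (QCDRegularisation.canonicalAF Nf).a k * M / (QCDRegularisation.canonicalAF Nf).Zm k := by
  have ha := (QCDRegularisation.canonicalAF Nf).a_pos k
  have hZ := (QCDRegularisation.canonicalAF Nf).Zm_pos k
  rw [canonicalAF_mcrit, zero_add]
  positivity

/-- **ON THE BRANCH, WITHOUT THE LOWER PIN THE CRUX IS TRIVIAL.** Along `canonicalAF`
(`m_crit ≡ 0`, both scalings inherited) clauses (a′) and (b″) hold for EVERY `N_f`, with `M₀ = 0`,
`b₀ = 2`, `ℓ = R = 1`, `δ ≡ 0`: every bare mass `a_k m_f/Z_m(k)` is `> 0`, so no Dirichlet cell is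
singular at a bare mass `≥ m_f(k)` (cell positivity domain) — the cover event of (a′) is EMPTY — and
`Re det D_W > 0` at the upper pin mass (Seiler) — the indicator of (b″) vanishes; both numerators
are `∫ 0 = 0` and `0/x = 0`. [folklore] -/
theorem withoutLowerPinAt_canonicalAF (Nf : ℕ) :
    EarlyCrosserLawWithoutLowerPinAt Nf (QCDRegularisation.canonicalAF Nf) := by
  refine ⟨QCDRegularisation.canonicalAF_hasMassScaling, canonicalAF_hasAsymptoticScaling Nf, 0,
    le_rfl, 2, le_rfl, 1, one_pos, fun m hm => ⟨1, one_pos, ?_, ?_⟩⟩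
  · -- (a′): the cover event is empty, δ ≡ 0
    intro ε hε
    refine Filter.Eventually.of_forall fun k S _hS => ?_
    dsimp only
    refine ⟨fun _ => 0, fun _ => le_rfl, by simp [hε.le], ?_⟩
    intro j _hj s _hs E hE
    have hE0 : ∀ U, ¬ E U := by
      intro U hU
      obtain ⟨f, μ', hμ', hsing⟩ := hE U hU
      have hμ'pos : 0 < μ' := lt_of_lt_of_le (canonicalAF_bareMass_pos Nf (hm f) k) hμ'
      rcases hsing with h | ⟨c, h⟩
      · exact wilsonCell_det_ne_zero_of_pos U hμ'pos _ _ h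
      · exact wilsonCell_det_ne_zero_of_pos U hμ'pos _ _ h
    simp [hE0]
  · -- (b″): positive bare mass ⇒ Re det > 0 ⇒ the sign indicator vanishes
    intro M hM
    refine Filter.Eventually.of_forall fun k S _hS _hS2 => ?_
    dsimp only
    have hmass := canonicalAF_bareMass_pos Nf hM k
    have hpos : ∀ U : GaugeConfig 4 (2 * S + 1) (Matrix.specialUnitaryGroup (Fin 3) ℂ),
        ¬ (fermionDet (wilsonDirac (fundamentalRep (Fin 3)) U
          ((QCDRegularisation.canonicalAF Nf).mcrit k + (QCDRegularisation.canonicalAF Nf).a k * M /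
            (QCDRegularisation.canonicalAF Nf).Zm k) 1)).re < 0 :=
      fun U => not_lt.mpr (fermionDet_wilsonDirac_re_pos (fundamentalRep (Fin 3))
        fundamentalRep_mem_unitaryGroup U hmass).le
    simp [hpos]

/-- **Stub `onBranch_withoutLowerPin_holds`** (line `cells-inherit-torus-extinction`): the
lower-pin-free crux holds ON THE PHYSICAL BRANCH `m_crit → 0`, for every `N_f` — witnessed by
`canonicalAF`. So even with the branch conjunct the lower pin (b) is the only load-bearing clause.
[folklore] -/
theorem onBranch_withoutLowerPin_holds (Nf : ℕ) :
    ∃ reg : QCDRegularisation Nf, Filter.Tendsto reg.mcrit Filter.atTop (nhds 0) ∧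
      EarlyCrosserLawWithoutLowerPinAt Nf reg :=
  ⟨QCDRegularisation.canonicalAF Nf, canonicalAF_tendsto_mcrit Nf, withoutLowerPinAt_canonicalAF Nf⟩

/-- **Stub `onBranch_upperPin_holds`** (line `cells-inherit-torus-extinction`): the projection of
`onBranch_withoutLowerPin_holds` onto the two scalings, the branch conjunct and the upper pin (b″)
(clause (a′) dropped). [folklore] -/
theorem onBranch_upperPin_holds (Nf : ℕ) :
    ∃ reg : QCDRegularisation Nf, reg.HasMassScaling ∧ (reg.scheme 0 0 0).HasAsymptoticScaling ∧
      Filter.Tendsto reg.mcrit Filter.atTop (nhds 0) ∧ ∃ M₀ : ℝ, 0 ≤ M₀ ∧ ∀ m : Fin Nf → ℝ,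
        (∀ f, M₀ < m f) → ∃ R : ℝ, 0 < R ∧ UpperPin Nf reg M₀ m R := by
  obtain ⟨reg, hb, h1, h2, M₀, hM₀, b₀, -, ℓ, -, hm⟩ := onBranch_withoutLowerPin_holds Nf
  refine ⟨reg, h1, h2, hb, M₀, hM₀, fun m hmm => ?_⟩
  obtain ⟨R, hR, -, hU⟩ := hm m hmm
  exact ⟨R, hR, hU⟩

end OnBranch

end Summit.QuantumFields.QCD.Theorems.EarlyCrosserLawNegative

end
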